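import Literature.Computability.Complexity.CliqueThresholdBounds
import Literature.Computability.Complexity.CliqueRestriction
import Literature.Computability.Complexity.RossmanMonotoneCliqueLemma23Proofs
import Literature.Computability.Complexity.RossmanMonotoneCliqueProofs
import HarnessLib

/-!
# Rossman 2010, Theorem 2 from Theorem 1 (the argument of §7 and Appendix B)

B. Rossman, *The monotone complexity of k-clique on random graphs*, FOCS 2010 / SIAM J. Comput.
43 (2014) [Rossman2010], full version p. 10 (§7, proof of Theorem 2 via Lemma 17) and pp. 13–14
(Appendix B, proof of Lemma 17 from Lemma 23).

This file PROVES the deduction of **Theorem 2 in its strongest printed form**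
(`Rossman2010_twoThresholds`: fan-in-2 monotone circuits a.a.s. correct for `k`-CLIQUE on both
`G(n,p)` and `G(n, p + p^{1+ε})`, `p ∈ Θ(n^{-2/(k-1)})`, have size `ω(n^{k/4})`) from
Theorem 1 of the paper (`Rossman2010_cliqueVsSubcritical`, the quasi-sunflower /
approximation-method core of §4–§6, a named fact of `RossmanMonotoneClique.lean`, used at
`δ = k⁻³`) together with Lemma 23 (`Rossman2010_plantedVsConditioned`, App. B: `G(n,p) | {ω_k = 1}`
and `G(n,p) ∪ K_A | {ω_k(G) = 0}` are `o(1)`-close), which is PROVED in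
`RossmanMonotoneCliqueLemma23Proofs.lean` (`Rossman2010_plantedVsConditioned_holds`).

`Rossman2010_twoThresholds_of_thm1_lemma23 : Rossman2010_cliqueVsSubcritical →
Rossman2010_plantedVsConditioned → Rossman2010_twoThresholds` is the deduction with both inputs
explicit; `Rossman2010_twoThresholds_of_cliqueVsSubcritical : Rossman2010_cliqueVsSubcritical →
Rossman2010_twoThresholds` feeds it the proved Lemma 23, so that Theorem 2 (and with it the
headline form `Rossman2010_twoThresholds.allDensities` and the constant-free-basis form
`Rossman2010_twoThresholds.monotoneBasis`) is conditional on Theorem 1 ALONE; Theorem 1 is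
PROVED in `RossmanMonotoneCliqueProofs.lean` (`Rossman2010_cliqueVsSubcritical_holds`, §4–§6 with
the tree's proved spread lemma in place of Janson's inequality), and the discharge
`Rossman2010_twoThresholds_holds : Rossman2010_twoThresholds` at the end of this file is the
one-liner `Rossman2010_twoThresholds_of_cliqueVsSubcritical Rossman2010_cliqueVsSubcritical_holds`;
`Rossman2010_sizeOmega_of_solvesCliqueAAS` is the unconditional headline Theorem 2.

## The printed proof and its formalization

§7 (p. 10): "Suppose `C` solves `k`-clique on random graphs. For any graph `H`, form `C^H` by
relabeling input nodes in `E(H)` by the constant `1`, so `C^H(G) = C(G ∪ H)`. Lemma 17 gives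
`E[C^{G^θ}(G⁻) | ω_k(G^θ) = 0] < o(1)` and `E[C^{G^θ}(K_A) | ω_k(G^θ) = 0] > 1 - o(1)`. Therefore
there exists `H` with `E[C^H(K_A)] > 1/2` and `E[C^H(G⁻)] < 1/2`; Theorem 1 applied to `C^H` gives
`|C| = |C^H| > ω(n^{k/4})`." Here:

* `Circuit.exists_restrict_sup` — the restriction `C^H` in the straight-line model: a circuit over
  `{∧₂, ∨₂, 0, 1}` with at most one more gate (the constant `1`) computing `x ↦ C(H ∨ x)`
  (`CktSize.comp` of `CircuitComposition.lean`); `Circuit.monotone_eval_of_isOver_monotoneBasis01`.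
* Lemma 17, second inequality (`sum_cliqueFree_mul_kSubsetProb_false_le`, pointwise in `n`):
  `E_{G: ω_k(G)=0}[Pr_A[f(G ∪ K_A) = 0]] ≤ Pr[f(G) ≠ CLIQUE(G)] / Pr[ω_k(G) = 1] + TV_n`, where
  `TV_n` is the total variation distance of Lemma 23; with `Pr[ω_k = 1] ≥ Ω(1)`
  (`eventually_le_gnpProb_cliqueCount_eq_one`, Harris) and a.a.s. correctness on `G(n,p)` this is
  `o(1)`.
* Lemma 17, first inequality, in the "two thresholds" form: by the union law
  `G(n,p) ∪ G⁻ ∼ G(n, p + p⁻ - p p⁻)`, the sprinkling bound and monotonicity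
  (`GnpSprinkling.lean`), `E_{G: ω_k(G)=0}[Pr_{G⁻}[C(G ∪ G⁻) = 1]] ≤ Pr_{p⁺}[C = 1 ∧ ω_k = 0] +
  C(n,k)((p⁺)^{C(k,2)} - p^{C(k,2)}) = o(1)` as soon as `p + p⁻ ≤ p⁺ = p + p^{1+ε}`, which holds
  eventually because `p⁻ = n^{-2(1+δ)/(k-1)}` and `δ = k⁻³ > ε` (this is where
  `ε₀ = k⁻³/2` comes from); a.a.s. correctness on `G(n,p⁺)` and `tendsto_choose_mul_pow_sub_pow`
  finish.
* "there exists a graph `H`" — for each `n` we take `H_n` minimizing the sum of the two conditional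
  quantities over `{ω_k = 0}` (its `G(n,p)`-average is `o(1)` and `Pr[ω_k = 0] ≥ Ω(1)` by
  `eventually_le_gnpProb_cliqueFree`), and "size `ω(n^{k/4})`" for SEQUENCES — if
  `|C_n|/n^{k/4} ↛ ∞` then `|C_n| ≤ M n^{k/4}` frequently; the sequence `C_n^{H_n}` (the constant
  circuit `1` at the other `n`) satisfies the hypotheses of Theorem 1, whose conclusion
  `Pr[C_n^{H_n}(G⁻) = 1] ≥ 1 - exp(-n^{Ω(1)})` contradicts `Pr[C_n^{H_n}(G⁻) = 1] ≤ o(1)` at those `n`.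

Everything in this file is proved, and with Theorem 1 and Lemma 23 proved in the sibling files the
results at the end of the file are unconditional.

## References

* [Rossman2010] B. Rossman, The monotone complexity of k-clique on random graphs, FOCS 2010,
  193–201; SIAM J. Comput. 43 (2014) 256–279 — Thm. 2 (p. 4), §7 (p. 10), App. B (pp. 13–14).
-/

noncomputable section

namespace Literature.Computability.Complexity

open Finset Filter Asymptotics GateList
open scoped _root_.Topology

/-! ### Monotone circuits with constants: monotonicity and restriction -/

/-- A circuit over `{∧₂, ∨₂, 0, 1}` computes a monotone function (Rossman 2010, §2, "monotone
circuits on graphs": inputs are potential edges or the constants `0, 1`, gates are `∧`/`∨`).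
[folklore] -/
theorem Circuit.monotone_eval_of_isOver_monotoneBasis01 {ι : Type*} (C : Circuit ι)
    (hC : C.IsOver monotoneBasis01) : Monotone C.eval := by
  have h := monotone_wireOf_vals01 C.gates (wf_gates C) hC C.output C.wf_output
  intro x y hxy
  rw [circuit_eval, circuit_eval]
  exact h hxy

/-- The one-gate constant circuit is over `{∧₂, ∨₂, 0, 1}`. [folklore] -/
theorem Circuit.const_isOver_monotoneBasis01 (ι : Type*) (b : Bool) :
    (Circuit.const ι b).IsOver monotoneBasis01 := by
  intro g hg
  simp only [Circuit.const, List.mem_singleton] at hg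
  subst hg
  cases b
  · exact Set.mem_insert_of_mem _ (Set.mem_insert _ _)
  · exact Set.mem_insert _ _

/-- **Restriction `C^H`** (Rossman 2010, §7, proof of Theorem 2: "form a new monotone circuit `C^H`
simply by relabeling input nodes in `C` corresponding to edges in `H` by the constant `1`. Note that
`C^H(G) = C(G ∪ H)`"). In the straight-line model: for a circuit `C` over `{∧₂, ∨₂, 0, 1}` and a
fixed input vector `H` there is a circuit over the same basis with at most one more gate (a
constant-`1` gate feeding the inputs in `H`) computing `x ↦ C(H ∨ x)`.
[cite: Rossman2010, §7 (proof of Thm 2, p. 10)] -/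
theorem Circuit.exists_restrict_sup {ι : Type*} (C : Circuit ι) (hC : C.IsOver monotoneBasis01)
    (H : ι → Bool) :
    ∃ C' : Circuit ι, C'.IsOver monotoneBasis01 ∧ C'.size ≤ C.size + 1 ∧
      ∀ x, C'.eval x = C.eval (H ⊔ x) := by
  classical
  have hC' : CktSize monotoneBasis01 (fun (x : ι → Bool) (_ : Unit) => C.eval x) C.size :=
    ⟨C.gates, fun _ => C.output, le_rfl,
      ⟨wf_gates C, hC, fun _ m hm => C.wf_output m hm, fun x _ => (circuit_eval C x).symm⟩⟩
  have hor : CktSize monotoneBasis01 (fun (x : ι → Bool) (e : ι) => (H ⊔ x) e) 1 := by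
    refine ⟨[GateList.constGate ι true], fun e => if H e = true then Sum.inr 0 else Sum.inl e, le_rfl,
      ⟨WF.singleton (gateOK_constGate 0 true), ?_, ?_, ?_⟩⟩
    · intro g hg
      rw [List.mem_singleton] at hg
      subst hg
      exact Set.mem_insert _ _
    · intro e m hm
      dsimp only at hm
      by_cases h : H e = true
      · rw [if_pos h, Sum.inr.injEq] at hm
        subst hm
        exact Nat.one_pos
      · rw [if_neg h] at hm
        cases hm
    · intro x e
      by_cases h : H e = true
      · rw [if_pos h, sup_apply_bool, h, Bool.true_or]
        rfl
      · rw [if_neg h, sup_apply_bool, eq_false_of_ne_true h, Bool.false_or]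
        rfl
  obtain ⟨C', h1, h2, h3⟩ := (hor.comp hC').toCircuit
  exact ⟨C', h1, by omega, fun x => h3 x⟩

/-! ### The law of the random `k`-clique: complements and constants -/

/-- `kSubsetProb` only depends on the event. [folklore] -/
theorem kSubsetProb_congr {n k : ℕ} {P Q : Finset (Fin n) → Prop} [DecidablePred P] [DecidablePred Q]
    (h : ∀ A, P A ↔ Q A) : kSubsetProb n k P = kSubsetProb n k Q := by
  unfold kSubsetProb
  rw [filter_congr fun A _ => h A]

/-- Complements: `Pr_A[¬ P] = 1 - Pr_A[P]` (for `k ≤ n`, so that `k`-sets exist). [folklore] -/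
theorem kSubsetProb_not {n k : ℕ} (hkn : k ≤ n) (P : Finset (Fin n) → Prop) [DecidablePred P] :
    kSubsetProb n k (fun A => ¬ P A) = 1 - kSubsetProb n k P := by
  unfold kSubsetProb
  have hN : (0 : ℝ) < n.choose k := by exact_mod_cast Nat.choose_pos hkn
  have h := card_filter_add_card_filter_not (s := powersetCard k (univ : Finset (Fin n))) P
  rw [card_powersetCard, card_univ, Fintype.card_fin] at h
  rw [eq_sub_iff_add_eq, ← add_div, div_eq_one_iff_eq hN.ne']
  rw [add_comm] at h
  exact_mod_cast h

/-- The sure event has probability `1` (for `k ≤ n`). [folklore] -/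
theorem kSubsetProb_true {n k : ℕ} (hkn : k ≤ n) : kSubsetProb n k (fun _ => True) = 1 := by
  unfold kSubsetProb
  rw [filter_true_of_mem fun _ _ => trivial, card_powersetCard, card_univ, Fintype.card_fin,
    div_self]
  exact_mod_cast (Nat.choose_pos hkn).ne'

/-! ### Asymptotic bookkeeping -/

/-- A nonnegative sequence in `Θ(θ)`, `θ ≥ 0`, is eventually squeezed between positive multiples of
`θ`. [folklore] -/
theorem exists_bounds_of_isTheta {p θ : ℕ → ℝ} (hp : ∀ n, 0 ≤ p n) (hθ : ∀ n, 0 ≤ θ n)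
    (h : p =Θ[atTop] θ) :
    ∃ a b : ℝ, 0 < a ∧ 1 ≤ b ∧ ∀ᶠ n in atTop, a * θ n ≤ p n ∧ p n ≤ b * θ n := by
  obtain ⟨c, hc⟩ := h.1.bound
  obtain ⟨c', hc'pos, hc'⟩ := h.2.exists_pos
  refine ⟨1 / c', max c 1, by positivity, le_max_right _ _, ?_⟩
  filter_upwards [hc, hc'.bound] with n h1 h2
  rw [Real.norm_of_nonneg (hp n), Real.norm_of_nonneg (hθ n)] at h1 h2
  constructor
  · rw [one_div, inv_mul_le_iff₀ hc'pos]
    exact h2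
  · exact h1.trans (mul_le_mul_of_nonneg_right (le_max_left _ _) (hθ n))

/-- If `|C_n| / n^{k/4}` does not tend to infinity then `|C_n| ≤ M n^{k/4}` for infinitely many
`n`, for some `M ≥ 1` (negation of "size `ω(n^{k/4})`" for a sequence of circuits). [folklore] -/
theorem exists_frequently_size_le {k : ℕ} {C : (n : ℕ) → Circuit ((⊤ : SimpleGraph (Fin n)).edgeSet)}
    (h : ¬ Tendsto (fun n => ((C n).size : ℝ) / (n : ℝ) ^ ((k : ℝ) / 4)) atTop atTop) :
    ∃ M : ℝ, 1 ≤ M ∧ ∃ᶠ n : ℕ in atTop, ((C n).size : ℝ) ≤ M * (n : ℝ) ^ ((k : ℝ) / 4) := by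
  rw [tendsto_atTop] at h
  push Not at h
  obtain ⟨b, hb⟩ := h
  refine ⟨max b 1, le_max_right _ _, ?_⟩
  refine (hb.and_eventually (eventually_ge_atTop 1)).mono fun n hn => ?_
  obtain ⟨hlt, hn1⟩ := hn
  have hpos : (0 : ℝ) < (n : ℝ) ^ ((k : ℝ) / 4) := Real.rpow_pos_of_pos (by exact_mod_cast hn1) _
  rw [div_lt_iff₀ hpos] at hlt
  exact hlt.le.trans (mul_le_mul_of_nonneg_right (le_max_left _ _) hpos.le)

/-! ### Lemma 17, second inequality (pointwise in `n`) -/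

/-- **Lemma 17, second inequality, pointwise** (Rossman 2010, App. B, p. 14: "`G^θ ∪ K_A`
conditioned on `ω_k(G^θ) = 0` and `G^θ` conditioned on `ω_k(G^θ) = 1` have total variation
distance `o(1)` by Lemma 23. It follows that
`E[f(G^θ ∪ K_A) | ω_k(G^θ) = 0] > E[f(G^θ) | ω_k(G^θ) = 1] - o(1) > 1 - o(1)`"). Unconditioned
finite form, for any Boolean `f`, `p ∈ [0,1]`, `k ≤ n` and `Pr[ω_k = 1] > 0`:
`Σ_{G : ω_k(G)=0} w_p(G) · Pr_A[f(G ∪ K_A) = 0] ≤ Pr[f(G) ≠ CLIQUE_k(G)] / Pr[ω_k(G) = 1] + TV`,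
where `TV = Σ_H |Pr[G = H | ω_k = 1] - Pr[G ∪ K_A = H | ω_k(G) = 0]|` is the distance of Lemma 23
(`condOneCliqueLaw`, `plantedCliqueFreeLaw`). [cite: Rossman2010, App. B (proof of Lemma 17, p. 14)] -/
theorem sum_cliqueFree_mul_kSubsetProb_false_le {n : ℕ} {p : ℝ} (hp0 : 0 ≤ p) (hp1 : p ≤ 1)
    {k : ℕ} (hkn : k ≤ n) (f : ((⊤ : SimpleGraph (Fin n)).edgeSet → Bool) → Bool)
    (hP₁ : 0 < gnpProb n p (univ.filter fun x => cliqueCount n k x = 1)) :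
    ∑ H ∈ univ.filter (fun H : (⊤ : SimpleGraph (Fin n)).edgeSet → Bool => cliqueCount n k H = 0),
        gnpWeight n p H * kSubsetProb n k (fun A => f (plantClique A H) = false) ≤
      gnpProb n p (univ.filter fun x => f x ≠ cliqueFn n k x) /
          gnpProb n p (univ.filter fun x => cliqueCount n k x = 1) +
        ∑ G, |condOneCliqueLaw n k p G - plantedCliqueFreeLaw n k p G| := by
  classical
  set 𝒜 := powersetCard k (univ : Finset (Fin n)) with h𝒜
  set N : ℝ := (n.choose k : ℝ) with hN
  set P₀ := gnpProb n p (univ.filter fun x : (⊤ : SimpleGraph (Fin n)).edgeSet → Bool =>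
    cliqueCount n k x = 0) with hP₀def
  set P₁ := gnpProb n p (univ.filter fun x : (⊤ : SimpleGraph (Fin n)).edgeSet → Bool =>
    cliqueCount n k x = 1) with hP₁def
  have hNpos : 0 < N := by rw [hN]; exact_mod_cast Nat.choose_pos hkn
  have hTV : 0 ≤ ∑ G, |condOneCliqueLaw n k p G - plantedCliqueFreeLaw n k p G| :=
    sum_nonneg fun _ _ => abs_nonneg _
  have herr : 0 ≤ gnpProb n p (univ.filter fun x => f x ≠ cliqueFn n k x) / P₁ :=
    div_nonneg (gnpProb_nonneg hp0 hp1 _) hP₁.le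
  -- the numerator of the planted law
  set numer : ((⊤ : SimpleGraph (Fin n)).edgeSet → Bool) → ℝ := fun G =>
    ∑ A ∈ 𝒜, gnpProb n p (univ.filter fun x => cliqueCount n k x = 0 ∧ plantClique A x = G)
    with hnumer
  have hplanted : ∀ G, plantedCliqueFreeLaw n k p G = numer G / (N * P₀) := fun G => rfl
  have hcond : ∀ G, condOneCliqueLaw n k p G =
      (if cliqueCount n k G = 1 then gnpWeight n p G else 0) / P₁ := fun G => rfl
  -- Step 1: the left-hand side in terms of the numerators
  have hk : ∀ H : (⊤ : SimpleGraph (Fin n)).edgeSet → Bool,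
      kSubsetProb n k (fun A => f (plantClique A H) = false) =
        (∑ A ∈ 𝒜, if f (plantClique A H) = false then (1 : ℝ) else 0) / N := by
    intro H
    unfold kSubsetProb
    rw [Finset.card_filter]
    push_cast
    rfl
  have hnum : ∀ G, numer G = ∑ A ∈ 𝒜,
      ∑ x ∈ univ.filter (fun x : (⊤ : SimpleGraph (Fin n)).edgeSet → Bool => cliqueCount n k x = 0),
        gnpWeight n p x * (if plantClique A x = G then 1 else 0) := by
    intro G
    simp only [hnumer]
    refine sum_congr rfl fun A _ => ?_
    rw [gnpProb, sum_filter, sum_filter]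
    refine sum_congr rfl fun x _ => ?_
    by_cases h0 : cliqueCount n k x = 0 <;> by_cases h1 : plantClique A x = G <;> simp [h0, h1]
  have hLHS : ∑ H ∈ univ.filter (fun H : (⊤ : SimpleGraph (Fin n)).edgeSet → Bool => cliqueCount n k H = 0),
        gnpWeight n p H * kSubsetProb n k (fun A => f (plantClique A H) = false) =
      (∑ G, (if f G = false then (1 : ℝ) else 0) * numer G) / N := by
    calc ∑ H ∈ univ.filter (fun H : (⊤ : SimpleGraph (Fin n)).edgeSet → Bool => cliqueCount n k H = 0),
          gnpWeight n p H * kSubsetProb n k (fun A => f (plantClique A H) = false)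
        = ∑ H ∈ univ.filter (fun H : (⊤ : SimpleGraph (Fin n)).edgeSet → Bool => cliqueCount n k H = 0),
            (∑ A ∈ 𝒜, gnpWeight n p H * (if f (plantClique A H) = false then (1 : ℝ) else 0)) / N := by
          refine sum_congr rfl fun H _ => ?_
          rw [hk H, ← mul_div_assoc, mul_sum]
      _ = (∑ A ∈ 𝒜, ∑ H ∈ univ.filter (fun H : (⊤ : SimpleGraph (Fin n)).edgeSet → Bool =>
            cliqueCount n k H = 0),
              gnpWeight n p H * (if f (plantClique A H) = false then (1 : ℝ) else 0)) / N := by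
          rw [← sum_div, sum_comm]
      _ = (∑ G, (if f G = false then (1 : ℝ) else 0) * numer G) / N := by
          congr 1
          simp_rw [hnum, mul_sum]
          conv_rhs => rw [sum_comm]
          refine sum_congr rfl fun A _ => ?_
          conv_rhs => rw [sum_comm]
          refine sum_congr rfl fun H _ => ?_
          rw [sum_eq_single_of_mem (plantClique A H) (mem_univ _)]
          · rw [if_pos rfl, mul_one, mul_comm]
          · intro G _ hG
            rw [if_neg (Ne.symm hG), mul_zero, mul_zero]
  -- Step 2: the degenerate case `Pr[ω_k = 0] = 0`
  by_cases hP₀0 : P₀ = 0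
  · have hw0 : ∀ H ∈ univ.filter (fun H : (⊤ : SimpleGraph (Fin n)).edgeSet → Bool => cliqueCount n k H = 0),
        gnpWeight n p H = 0 :=
      (sum_eq_zero_iff_of_nonneg (fun H _ => gnpWeight_nonneg hp0 hp1 H)).1 hP₀0
    calc ∑ H ∈ univ.filter (fun H : (⊤ : SimpleGraph (Fin n)).edgeSet → Bool => cliqueCount n k H = 0),
          gnpWeight n p H * kSubsetProb n k (fun A => f (plantClique A H) = false) = 0 :=
          sum_eq_zero fun H hH => by rw [hw0 H hH, zero_mul]
      _ ≤ _ := add_nonneg herr hTV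
  -- Step 3: the main case
  have hP₀pos : 0 < P₀ := lt_of_le_of_ne (gnpProb_nonneg hp0 hp1 _) (Ne.symm hP₀0)
  have hP₀1 : P₀ ≤ 1 := gnpProb_le_one hp0 hp1 _
  have hNP : N * P₀ ≠ 0 := mul_ne_zero hNpos.ne' hP₀pos.ne'
  have hnumer_eq : ∀ G, numer G = N * P₀ * plantedCliqueFreeLaw n k p G := fun G => by
    rw [hplanted, mul_div_cancel₀ _ hNP]
  have hpl0 : ∀ G, 0 ≤ plantedCliqueFreeLaw n k p G := fun G => by
    rw [hplanted]
    exact div_nonneg (sum_nonneg fun A _ => gnpProb_nonneg hp0 hp1 _) (mul_nonneg hNpos.le hP₀pos.le)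
  have hN0 : N ≠ 0 := hNpos.ne'
  have h2 : (∑ G, (if f G = false then (1 : ℝ) else 0) * numer G) / N =
      P₀ * ∑ G, (if f G = false then (1 : ℝ) else 0) * plantedCliqueFreeLaw n k p G := by
    simp_rw [hnumer_eq]
    rw [mul_sum, sum_div]
    refine sum_congr rfl fun G _ => ?_
    rw [div_eq_iff hN0]
    ring
  have h3 : ∑ G, (if f G = false then (1 : ℝ) else 0) * plantedCliqueFreeLaw n k p G ≤
      ∑ G, (if f G = false then (1 : ℝ) else 0) * condOneCliqueLaw n k p G +
        ∑ G, |condOneCliqueLaw n k p G - plantedCliqueFreeLaw n k p G| := by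
    rw [← sum_add_distrib]
    refine sum_le_sum fun G _ => ?_
    have habs : plantedCliqueFreeLaw n k p G ≤ condOneCliqueLaw n k p G +
        |condOneCliqueLaw n k p G - plantedCliqueFreeLaw n k p G| := by
      have := neg_abs_le (condOneCliqueLaw n k p G - plantedCliqueFreeLaw n k p G)
      linarith
    split_ifs
    · rw [one_mul, one_mul]
      exact habs
    · rw [zero_mul, zero_mul, zero_add]
      exact abs_nonneg _
  have h4 : ∑ G, (if f G = false then (1 : ℝ) else 0) * condOneCliqueLaw n k p G ≤
      gnpProb n p (univ.filter fun x => f x ≠ cliqueFn n k x) / P₁ := by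
    simp_rw [hcond, mul_div_assoc']
    rw [← sum_div]
    refine div_le_div_of_nonneg_right ?_ hP₁.le
    rw [gnpProb, sum_filter]
    refine sum_le_sum fun G _ => ?_
    by_cases hf : f G = false
    · by_cases h1 : cliqueCount n k G = 1
      · have hcf : cliqueFn n k G = true :=
          (cliqueCount_ne_zero_iff G).1 (by rw [h1]; exact one_ne_zero)
        have hne : f G ≠ cliqueFn n k G := by rw [hf, hcf]; exact Bool.false_ne_true
        rw [if_pos hf, if_pos h1, if_pos hne, one_mul]
      · rw [if_pos hf, if_neg h1, mul_zero]
        split_ifs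
        · exact gnpWeight_nonneg hp0 hp1 G
        · exact le_rfl
    · rw [if_neg hf, zero_mul]
      split_ifs
      · exact gnpWeight_nonneg hp0 hp1 G
      · exact le_rfl
  have hsum0 : 0 ≤ ∑ G, (if f G = false then (1 : ℝ) else 0) * plantedCliqueFreeLaw n k p G :=
    sum_nonneg fun G _ => mul_nonneg (by split_ifs <;> norm_num) (hpl0 G)
  rw [hLHS, h2]
  calc P₀ * ∑ G, (if f G = false then (1 : ℝ) else 0) * plantedCliqueFreeLaw n k p G
      ≤ 1 * ∑ G, (if f G = false then (1 : ℝ) else 0) * plantedCliqueFreeLaw n k p G :=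
        mul_le_mul_of_nonneg_right hP₀1 hsum0
    _ = ∑ G, (if f G = false then (1 : ℝ) else 0) * plantedCliqueFreeLaw n k p G := one_mul _
    _ ≤ _ := h3.trans (add_le_add h4 le_rfl)

/-! ### Theorem 2 from Theorem 1 and Lemma 23 -/

/-- **Rossman 2010, Theorem 2 (strongest printed form) from Theorem 1 and Lemma 23** — the
argument of §7 (p. 10) with Lemma 17 proved from Lemma 23 as in Appendix B (p. 14), for
`δ = k⁻³` and `ε₀ = k⁻³ / 2`: if Theorem 1 (`Rossman2010_cliqueVsSubcritical`) and Lemma 23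
(`Rossman2010_plantedVsConditioned`) hold, then every sequence of fan-in-2 monotone circuits
(over `{∧₂, ∨₂, 0, 1}`, eventually) that solves `k`-clique a.a.s. on `G(n,p)` and on
`G(n, p + p^{1+ε})`, `p ∈ Θ(n^{-2/(k-1)})`, `0 < ε ≤ ε₀`, has size `ω(n^{k/4})`
(`Rossman2010_twoThresholds`). See the module docstring for the dictionary between the printed
proof and the lemmas used (restriction `C^H`, the two inequalities of Lemma 17 via the union law,
sprinkling, Harris' inequality and Lemma 23, the choice of `H_n`, and the diagonal sequence fed to
Theorem 1). [cite: Rossman2010, Thm 2 (p. 4; proof §7 p. 10 and App. B pp. 13–14)] -/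
theorem Rossman2010_twoThresholds_of_thm1_lemma23 (h₁ : Rossman2010_cliqueVsSubcritical)
    (h₂₃ : Rossman2010_plantedVsConditioned) : Rossman2010_twoThresholds := by
  classical
  intro k hk
  have hk2 : 2 ≤ k := le_trans (by norm_num) hk
  have hk1 : (0 : ℝ) < (k : ℝ) - 1 := by
    have : (5 : ℝ) ≤ k := by exact_mod_cast hk
    linarith
  have hkpos : (0 : ℝ) < k := by linarith
  have hδ : (0 : ℝ) < 1 / (k : ℝ) ^ 3 := by positivity
  obtain ⟨-, hThm1⟩ := h₁ k hk
  refine ⟨1 / (k : ℝ) ^ 3 / 2, half_pos hδ, ?_⟩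
  intro ε hε hεδ p hp01 hΘ C hC hsolve hsolve'
  by_contra hnot
  -- the three densities: `p`, `p⁻ = n^{-2(1+δ)/(k-1)}` (Theorem 1) and `p⁺ = p + p^{1+ε}`
  have hθ0 : ∀ n : ℕ, 0 ≤ (n : ℝ) ^ (-(2 : ℝ) / ((k : ℝ) - 1)) := fun n =>
    Real.rpow_nonneg (Nat.cast_nonneg n) _
  have hpm01 : ∀ n : ℕ, 0 ≤ (n : ℝ) ^ (-(2 * (1 + 1 / (k : ℝ) ^ 3)) / ((k : ℝ) - 1)) ∧
      (n : ℝ) ^ (-(2 * (1 + 1 / (k : ℝ) ^ 3)) / ((k : ℝ) - 1)) ≤ 1 := by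
    intro n
    have hexp : -(2 * (1 + 1 / (k : ℝ) ^ 3)) / ((k : ℝ) - 1) ≤ 0 :=
      (div_neg_of_neg_of_pos (by linarith) hk1).le
    refine ⟨Real.rpow_nonneg (Nat.cast_nonneg n) _, ?_⟩
    rcases Nat.eq_zero_or_pos n with rfl | hn
    · rw [Nat.cast_zero, Real.zero_rpow (div_neg_of_neg_of_pos (by linarith) hk1).ne]
      exact zero_le_one
    · exact Real.rpow_le_one_of_one_le_of_nonpos (by exact_mod_cast hn) hexp
  -- unfolded a.a.s. hypotheses
  have hs1 : Tendsto (fun n => gnpProb n (p n)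
      (univ.filter fun x => (C n).eval x ≠ cliqueFn n k x)) atTop (𝓝 0) := hsolve
  have hs2 : Tendsto (fun n => gnpProb n (p n + p n ^ (1 + ε))
      (univ.filter fun x => (C n).eval x ≠ cliqueFn n k x)) atTop (𝓝 0) := hsolve'
  -- `Θ`-bounds for `p`
  obtain ⟨a, b, ha, hb, hab⟩ := exists_bounds_of_isTheta (p := p)
    (θ := fun n : ℕ => (n : ℝ) ^ (-(2 : ℝ) / ((k : ℝ) - 1))) (fun n => (hp01 n).1) hθ0 hΘ
  have hpb : ∀ᶠ n : ℕ in atTop, 0 ≤ p n ∧ p n ≤ b * (n : ℝ) ^ (-(2 : ℝ) / ((k : ℝ) - 1)) :=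
    hab.mono fun n hn => ⟨(hp01 n).1, hn.2⟩
  have hp0lim : Tendsto p atTop (𝓝 0) := by
    refine squeeze_zero' (Eventually.of_forall fun n => (hp01 n).1) (hpb.mono fun n hn => hn.2) ?_
    simpa using (tendsto_rpow_threshold hk2).const_mul b
  -- (A) `Pr[ω_k(G(n,p)) = 0] ≥ κ₀`
  have hκ₀pos : 0 < Real.exp (-(2 * b ^ k.choose 2)) := Real.exp_pos _
  have hA : ∀ᶠ n : ℕ in atTop, Real.exp (-(2 * b ^ k.choose 2)) ≤
      gnpProb n (p n) (univ.filter fun x => cliqueCount n k x = 0) :=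
    eventually_le_gnpProb_cliqueFree hk2 hb hpb
  -- (E1) `Pr[ω_k(G(n,p)) = 1] ≥ κ₁`
  have hκ₁pos : 0 < a ^ k.choose 2 / (2 ^ k * k.factorial) *
      Real.exp (-(2 * (k * 2 ^ k * b ^ k.choose 2))) := by positivity
  have hE1 : ∀ᶠ n : ℕ in atTop, a ^ k.choose 2 / (2 ^ k * k.factorial) *
      Real.exp (-(2 * (k * 2 ^ k * b ^ k.choose 2))) ≤
        gnpProb n (p n) (univ.filter fun x => cliqueCount n k x = 1) :=
    eventually_le_gnpProb_cliqueCount_eq_one hk2 ha hb hab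
  -- the two conditional quantities, averaged over `{ω_k = 0}`
  set aFn : (n : ℕ) → (((⊤ : SimpleGraph (Fin n)).edgeSet → Bool) → ℝ) := fun n H =>
    kSubsetProb n k (fun A => (C n).eval (plantClique A H) = false) with haFn
  set bFn : (n : ℕ) → (((⊤ : SimpleGraph (Fin n)).edgeSet → Bool) → ℝ) := fun n H =>
    gnpProb n ((n : ℝ) ^ (-(2 * (1 + 1 / (k : ℝ) ^ 3)) / ((k : ℝ) - 1)))
      (univ.filter fun y => (C n).eval (H ⊔ y) = true) with hbFn
  set R : ℕ → ℝ := fun n =>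
    ∑ H ∈ univ.filter (fun H : (⊤ : SimpleGraph (Fin n)).edgeSet → Bool => cliqueCount n k H = 0),
      gnpWeight n (p n) H * aFn n H with hR
  set S : ℕ → ℝ := fun n =>
    ∑ H ∈ univ.filter (fun H : (⊤ : SimpleGraph (Fin n)).edgeSet → Bool => cliqueCount n k H = 0),
      gnpWeight n (p n) H * bFn n H with hS
  have ha0 : ∀ n H, 0 ≤ aFn n H := fun n H => kSubsetProb_nonneg _ _ _
  have hb0 : ∀ n H, 0 ≤ bFn n H := fun n H => gnpProb_nonneg (hpm01 n).1 (hpm01 n).2 _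
  have hR0 : ∀ n, 0 ≤ R n := fun n =>
    sum_nonneg fun H _ => mul_nonneg (gnpWeight_nonneg (hp01 n).1 (hp01 n).2 H) (ha0 n H)
  have hS0 : ∀ n, 0 ≤ S n := fun n =>
    sum_nonneg fun H _ => mul_nonneg (gnpWeight_nonneg (hp01 n).1 (hp01 n).2 H) (hb0 n H)
  -- (B) Lemma 17, second inequality: `R → 0`
  have hRlim : Tendsto R atTop (𝓝 0) := by
    have hTV := h₂₃ k hk p hp01 hΘ
    have hmaj : Tendsto (fun n : ℕ => gnpProb n (p n)
        (univ.filter fun x => (C n).eval x ≠ cliqueFn n k x) /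
          (a ^ k.choose 2 / (2 ^ k * k.factorial) * Real.exp (-(2 * (k * 2 ^ k * b ^ k.choose 2)))) +
        ∑ G : (⊤ : SimpleGraph (Fin n)).edgeSet → Bool,
          |condOneCliqueLaw n k (p n) G - plantedCliqueFreeLaw n k (p n) G|) atTop (𝓝 0) := by
      simpa using (hs1.div_const (a ^ k.choose 2 / (2 ^ k * k.factorial) *
        Real.exp (-(2 * (k * 2 ^ k * b ^ k.choose 2))))).add hTV
    refine squeeze_zero' (Eventually.of_forall hR0) ?_ hmaj
    filter_upwards [hE1, eventually_ge_atTop k] with n hn1 hkn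
    have hP₁ : 0 < gnpProb n (p n) (univ.filter fun x => cliqueCount n k x = 1) :=
      hκ₁pos.trans_le hn1
    refine (sum_cliqueFree_mul_kSubsetProb_false_le (hp01 n).1 (hp01 n).2 hkn (C n).eval hP₁).trans ?_
    refine add_le_add ?_ le_rfl
    exact div_le_div_of_nonneg_left (gnpProb_nonneg (hp01 n).1 (hp01 n).2 _) hκ₁pos hn1
  -- (C) Lemma 17, first inequality (two-threshold form): `S → 0`
  have hSlim : Tendsto S atTop (𝓝 0) := by
    -- eventually `p⁻ ≤ p^{1+ε}` (this is where `δ = k⁻³ > ε` is used) and `p⁺ ≤ 1`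
    have hev1 : ∀ᶠ n : ℕ in atTop, (n : ℝ) ^ (-(2 * (1 + 1 / (k : ℝ) ^ 3)) / ((k : ℝ) - 1)) ≤
        p n ^ (1 + ε) := by
      have hgap : 0 < 1 / (k : ℝ) ^ 3 - ε := by linarith
      have hsmall : Tendsto (fun n : ℕ => ((n : ℝ) ^ (-(2 : ℝ) / ((k : ℝ) - 1))) ^
          (1 / (k : ℝ) ^ 3 - ε)) atTop (𝓝 0) := by
        have := (tendsto_rpow_threshold hk2).rpow_const (Or.inr hgap.le)
        rwa [Real.zero_rpow hgap.ne'] at this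
      filter_upwards [hab, eventually_ge_atTop 1,
        hsmall.eventually_le_const (Real.rpow_pos_of_pos ha (1 + ε))] with n hn hn1 hsm
      have hnpos : (0 : ℝ) < n := by exact_mod_cast hn1
      have hθpos : 0 < (n : ℝ) ^ (-(2 : ℝ) / ((k : ℝ) - 1)) := Real.rpow_pos_of_pos hnpos _
      calc (n : ℝ) ^ (-(2 * (1 + 1 / (k : ℝ) ^ 3)) / ((k : ℝ) - 1))
          = ((n : ℝ) ^ (-(2 : ℝ) / ((k : ℝ) - 1))) ^ (1 + 1 / (k : ℝ) ^ 3) := by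
            rw [← Real.rpow_mul hnpos.le]
            congr 1
            field_simp
        _ = ((n : ℝ) ^ (-(2 : ℝ) / ((k : ℝ) - 1))) ^ (1 + ε) *
              ((n : ℝ) ^ (-(2 : ℝ) / ((k : ℝ) - 1))) ^ (1 / (k : ℝ) ^ 3 - ε) := by
            rw [← Real.rpow_add hθpos]
            congr 1
            ring
        _ ≤ ((n : ℝ) ^ (-(2 : ℝ) / ((k : ℝ) - 1))) ^ (1 + ε) * a ^ (1 + ε) :=
            mul_le_mul_of_nonneg_left hsm (Real.rpow_nonneg hθpos.le _)
        _ = (a * (n : ℝ) ^ (-(2 : ℝ) / ((k : ℝ) - 1))) ^ (1 + ε) := by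
            rw [Real.mul_rpow ha.le hθpos.le, mul_comm]
        _ ≤ p n ^ (1 + ε) :=
            Real.rpow_le_rpow (mul_nonneg ha.le hθpos.le) hn.1 (by linarith)
    have hev2 : ∀ᶠ n : ℕ in atTop, p n + p n ^ (1 + ε) ≤ 1 := by
      filter_upwards [hp0lim.eventually_le_const (by norm_num : (0 : ℝ) < 1 / 2)] with n hn
      have : p n ^ (1 + ε) ≤ p n := Real.rpow_le_self_of_le_one (hp01 n).1 (hp01 n).2 (by linarith)
      linarith
    -- the sprinkling error `C(n,k)((p⁺)^K - p^K) → 0`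
    have hsprinkle : Tendsto (fun n : ℕ => (n.choose k : ℝ) *
        ((p n + p n ^ (1 + ε)) ^ k.choose 2 - p n ^ k.choose 2)) atTop (𝓝 0) := by
      refine tendsto_choose_mul_pow_sub_pow hk2 (zero_le_one.trans hb) hpb (r := fun n => p n ^ ε)
        (Eventually.of_forall fun n => ⟨?_, ?_⟩)
        (Eventually.of_forall fun n => Real.rpow_nonneg (hp01 n).1 ε) ?_
      · linarith [Real.rpow_nonneg (hp01 n).1 (1 + ε)]
      · rw [Real.rpow_add' (hp01 n).1 (by linarith : (1 : ℝ) + ε ≠ 0), Real.rpow_one]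
        linarith
      · have := hp0lim.rpow_const (Or.inr hε.le)
        rwa [Real.zero_rpow hε.ne'] at this
    have hmaj : Tendsto (fun n : ℕ => gnpProb n (p n + p n ^ (1 + ε))
        (univ.filter fun x => (C n).eval x ≠ cliqueFn n k x) +
          (n.choose k : ℝ) * ((p n + p n ^ (1 + ε)) ^ k.choose 2 - p n ^ k.choose 2))
            atTop (𝓝 0) := by
      simpa using hs2.add hsprinkle
    refine squeeze_zero' (Eventually.of_forall hS0) ?_ hmaj
    filter_upwards [hev1, hev2, hC] with n h1 h2 hCn
    obtain ⟨hp0, hp1⟩ := hp01 n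
    obtain ⟨hq0, hq1⟩ := hpm01 n
    have hmono : Monotone (C n).eval := (C n).monotone_eval_of_isOver_monotoneBasis01 hCn
    have hpε0 : 0 ≤ p n ^ (1 + ε) := Real.rpow_nonneg hp0 _
    -- the intermediate density `p₁ = p + p⁻ - p p⁻ ≤ p⁺`
    have hp₁le : p n + (n : ℝ) ^ (-(2 * (1 + 1 / (k : ℝ) ^ 3)) / ((k : ℝ) - 1)) -
        p n * (n : ℝ) ^ (-(2 * (1 + 1 / (k : ℝ) ^ 3)) / ((k : ℝ) - 1)) ≤ p n + p n ^ (1 + ε) := by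
      nlinarith [mul_nonneg hp0 hq0]
    have hpp₁ : p n ≤ p n + (n : ℝ) ^ (-(2 * (1 + 1 / (k : ℝ) ^ 3)) / ((k : ℝ) - 1)) -
        p n * (n : ℝ) ^ (-(2 * (1 + 1 / (k : ℝ) ^ 3)) / ((k : ℝ) - 1)) := by
      nlinarith [mul_nonneg (sub_nonneg.2 hp1) hq0]
    have hsub : (univ.filter fun z : (⊤ : SimpleGraph (Fin n)).edgeSet → Bool =>
        (C n).eval z = true ∧ cliqueCount n k z = 0) ⊆
          univ.filter fun x => (C n).eval x ≠ cliqueFn n k x := by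
      intro z hz
      rw [mem_filter] at hz ⊢
      refine ⟨hz.1, ?_⟩
      rw [hz.2.1, (cliqueCount_eq_zero_iff z).1 hz.2.2]
      exact Bool.false_ne_true.symm
    calc S n = ∑ H ∈ univ.filter (fun H : (⊤ : SimpleGraph (Fin n)).edgeSet → Bool =>
          cliqueCount n k H = 0), gnpWeight n (p n) H * bFn n H := rfl
      _ ≤ gnpProb n (p n + (n : ℝ) ^ (-(2 * (1 + 1 / (k : ℝ) ^ 3)) / ((k : ℝ) - 1)) -
              p n * (n : ℝ) ^ (-(2 * (1 + 1 / (k : ℝ) ^ 3)) / ((k : ℝ) - 1)))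
            (univ.filter fun z => (C n).eval z = true ∧ cliqueCount n k z = 0) +
          (n.choose k : ℝ) * ((p n + (n : ℝ) ^ (-(2 * (1 + 1 / (k : ℝ) ^ 3)) / ((k : ℝ) - 1)) -
              p n * (n : ℝ) ^ (-(2 * (1 + 1 / (k : ℝ) ^ 3)) / ((k : ℝ) - 1))) ^ k.choose 2 -
            p n ^ k.choose 2) :=
          sum_cliqueFree_gnpWeight_mul_gnpProb_sup_le hp0 hp1 hq0 hq1 k (C n).eval
      _ ≤ gnpProb n (p n + p n ^ (1 + ε))
            (univ.filter fun z => (C n).eval z = true ∧ cliqueCount n k z = 0) +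
          (n.choose k : ℝ) * ((p n + p n ^ (1 + ε)) ^ k.choose 2 -
            (p n + (n : ℝ) ^ (-(2 * (1 + 1 / (k : ℝ) ^ 3)) / ((k : ℝ) - 1)) -
              p n * (n : ℝ) ^ (-(2 * (1 + 1 / (k : ℝ) ^ 3)) / ((k : ℝ) - 1))) ^ k.choose 2) +
          (n.choose k : ℝ) * ((p n + (n : ℝ) ^ (-(2 * (1 + 1 / (k : ℝ) ^ 3)) / ((k : ℝ) - 1)) -
              p n * (n : ℝ) ^ (-(2 * (1 + 1 / (k : ℝ) ^ 3)) / ((k : ℝ) - 1))) ^ k.choose 2 -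
            p n ^ k.choose 2) :=
          add_le_add (gnpProb_pos_cliqueFree_mono (hp0.trans hpp₁) hp₁le h2 k hmono) le_rfl
      _ = gnpProb n (p n + p n ^ (1 + ε))
            (univ.filter fun z => (C n).eval z = true ∧ cliqueCount n k z = 0) +
          (n.choose k : ℝ) * ((p n + p n ^ (1 + ε)) ^ k.choose 2 - p n ^ k.choose 2) := by ring
      _ ≤ gnpProb n (p n + p n ^ (1 + ε)) (univ.filter fun x => (C n).eval x ≠ cliqueFn n k x) +
          (n.choose k : ℝ) * ((p n + p n ^ (1 + ε)) ^ k.choose 2 - p n ^ k.choose 2) :=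
          add_le_add (gnpProb_mono (by linarith) h2 hsub) le_rfl
  -- `τ = (R + S)/κ₀ → 0`
  set τ : ℕ → ℝ := fun n => (R n + S n) / Real.exp (-(2 * b ^ k.choose 2)) with hτ
  have hτlim : Tendsto τ atTop (𝓝 0) := by
    simpa using (hRlim.add hSlim).div_const (Real.exp (-(2 * b ^ k.choose 2)))
  -- the graph `H_n`: a worst clique-free graph for the two conditional quantities
  have hHex : ∀ n, ∃ H : (⊤ : SimpleGraph (Fin n)).edgeSet → Bool,
      Real.exp (-(2 * b ^ k.choose 2)) ≤ gnpProb n (p n) (univ.filter fun x => cliqueCount n k x = 0) →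
        aFn n H + bFn n H ≤ τ n := by
    intro n
    by_cases hκ : Real.exp (-(2 * b ^ k.choose 2)) ≤
        gnpProb n (p n) (univ.filter fun x => cliqueCount n k x = 0)
    · have hP₀pos : 0 < gnpProb n (p n) (univ.filter fun x => cliqueCount n k x = 0) :=
        hκ₀pos.trans_le hκ
      have hne : (univ.filter fun x : (⊤ : SimpleGraph (Fin n)).edgeSet → Bool =>
          cliqueCount n k x = 0).Nonempty := by
        rw [nonempty_iff_ne_empty]
        intro h0
        rw [h0, gnpProb, sum_empty] at hP₀pos
        exact lt_irrefl _ hP₀pos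
      obtain ⟨H₀, hH₀, hmin⟩ := exists_min_image _ (fun H => aFn n H + bFn n H) hne
      refine ⟨H₀, fun _ => ?_⟩
      have hle : gnpProb n (p n) (univ.filter fun x => cliqueCount n k x = 0) *
          (aFn n H₀ + bFn n H₀) ≤ R n + S n := by
        simp only [hR, hS]
        rw [← sum_add_distrib, gnpProb, sum_mul]
        refine sum_le_sum fun H hH => ?_
        rw [← mul_add]
        exact mul_le_mul_of_nonneg_left (hmin H hH) (gnpWeight_nonneg (hp01 n).1 (hp01 n).2 H)
      simp only [hτ]
      rw [le_div_iff₀ hκ₀pos]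
      calc (aFn n H₀ + bFn n H₀) * Real.exp (-(2 * b ^ k.choose 2))
          ≤ (aFn n H₀ + bFn n H₀) * gnpProb n (p n) (univ.filter fun x => cliqueCount n k x = 0) :=
            mul_le_mul_of_nonneg_left hκ (add_nonneg (ha0 n H₀) (hb0 n H₀))
        _ ≤ R n + S n := by rw [mul_comm]; exact hle
    · exact ⟨fun _ => false, fun h => absurd h hκ⟩
  choose H hH using hHex
  -- the diagonal sequence of restricted circuits `C_n^{H_n}` (constant `1` off the small-size `n`)
  obtain ⟨M, hM1, hfreq⟩ := exists_frequently_size_le hnot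
  have hDex : ∀ n, ∃ D : Circuit ((⊤ : SimpleGraph (Fin n)).edgeSet), D.IsOver monotoneBasis01 ∧
      (((C n).IsOver monotoneBasis01 ∧ ((C n).size : ℝ) ≤ M * (n : ℝ) ^ ((k : ℝ) / 4)) →
        D.size ≤ (C n).size + 1 ∧ ∀ x, D.eval x = (C n).eval (H n ⊔ x)) ∧
      (¬ ((C n).IsOver monotoneBasis01 ∧ ((C n).size : ℝ) ≤ M * (n : ℝ) ^ ((k : ℝ) / 4)) →
        D = Circuit.const _ true) := by
    intro n
    by_cases hg : (C n).IsOver monotoneBasis01 ∧ ((C n).size : ℝ) ≤ M * (n : ℝ) ^ ((k : ℝ) / 4)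
    · obtain ⟨D, hD1, hD2, hD3⟩ := (C n).exists_restrict_sup hg.1 (H n)
      exact ⟨D, hD1, fun _ => ⟨hD2, hD3⟩, fun h => absurd hg h⟩
    · exact ⟨Circuit.const _ true, Circuit.const_isOver_monotoneBasis01 _ true,
        fun h => absurd h hg, fun _ => rfl⟩
  choose D hDover hDgood hDbad using hDex
  -- hypotheses of Theorem 1 for `D`
  have hDsize : ∃ c : ℝ, ∀ᶠ n : ℕ in atTop, ((D n).size : ℝ) ≤ c * (n : ℝ) ^ ((k : ℝ) / 4) := by
    refine ⟨M + 2, ?_⟩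
    filter_upwards [eventually_ge_atTop 1] with n hn1
    have hnk : 1 ≤ (n : ℝ) ^ ((k : ℝ) / 4) := Real.one_le_rpow (by exact_mod_cast hn1) (by positivity)
    by_cases hg : (C n).IsOver monotoneBasis01 ∧ ((C n).size : ℝ) ≤ M * (n : ℝ) ^ ((k : ℝ) / 4)
    · have h1 : ((D n).size : ℝ) ≤ (C n).size + 1 := by exact_mod_cast (hDgood n hg).1
      linarith [hg.2]
    · rw [hDbad n hg, Circuit.size_const, Nat.cast_one]
      have h1 : (1 : ℝ) * 1 ≤ (M + 2) * (n : ℝ) ^ ((k : ℝ) / 4) :=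
        mul_le_mul (by linarith) hnk zero_le_one (by linarith)
      linarith
  have hDacc : ∃ η : ℝ, 0 < η ∧ ∀ᶠ n : ℕ in atTop,
      η ≤ kSubsetProb n k (fun A => (D n).eval (cliqueVec A) = true) := by
    refine ⟨1 / 2, by norm_num, ?_⟩
    filter_upwards [hA, hτlim.eventually_le_const (by norm_num : (0 : ℝ) < 1 / 2),
      eventually_ge_atTop k] with n hAn hτn hkn
    by_cases hg : (C n).IsOver monotoneBasis01 ∧ ((C n).size : ℝ) ≤ M * (n : ℝ) ^ ((k : ℝ) / 4)
    · have heval := (hDgood n hg).2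
      have hHn := hH n hAn
      have hkey : kSubsetProb n k (fun A => (D n).eval (cliqueVec A) = true) = 1 - aFn n (H n) := by
        simp only [haFn]
        rw [← kSubsetProb_not hkn]
        refine kSubsetProb_congr fun A => ?_
        rw [heval, ← plantClique_eq_sup, Bool.not_eq_false]
      rw [hkey]
      linarith [hb0 n (H n)]
    · rw [hDbad n hg]
      have h1 : kSubsetProb n k (fun A => (Circuit.const _ true).eval (cliqueVec A) = true) = 1 := by
        rw [kSubsetProb_congr (Q := fun _ => True) (fun A => by simp), kSubsetProb_true hkn]
      rw [h1]
      norm_num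
  -- Theorem 1
  obtain ⟨c', hc', hev⟩ := hThm1 D (Eventually.of_forall hDover) hDsize hDacc
  -- `exp(-n^{c'}) → 0`
  have hexp : Tendsto (fun n : ℕ => Real.exp (-((n : ℝ) ^ c'))) atTop (𝓝 0) :=
    Real.tendsto_exp_atBot.comp (tendsto_neg_atTop_atBot.comp
      ((tendsto_rpow_atTop hc').comp tendsto_natCast_atTop_atTop))
  -- a small-size `n` where everything holds
  have hfreq' : ∃ᶠ n : ℕ in atTop,
      (C n).IsOver monotoneBasis01 ∧ ((C n).size : ℝ) ≤ M * (n : ℝ) ^ ((k : ℝ) / 4) :=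
    (hfreq.and_eventually hC).mono fun n h => ⟨h.2, h.1⟩
  obtain ⟨n, hg, h1n, h3n, h4n, hAn⟩ := (hfreq'.and_eventually (hev.and
    ((hexp.eventually_le_const (by norm_num : (0 : ℝ) < 1 / 4)).and
      ((hτlim.eventually_le_const (by norm_num : (0 : ℝ) < 1 / 4)).and hA)))).exists
  have heval := (hDgood n hg).2
  have hHn := hH n hAn
  -- `Pr[C_n^{H_n}(G⁻) = 1]` is both `≥ 1 - exp(-n^{c'}) ≥ 3/4` and `≤ τ_n ≤ 1/4`
  have hkey : gnpProb n ((n : ℝ) ^ (-(2 * (1 + 1 / (k : ℝ) ^ 3)) / ((k : ℝ) - 1)))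
      (univ.filter fun x => (D n).eval x = true) = bFn n (H n) := by
    simp only [hbFn]
    congr 1
    ext x
    simp only [mem_filter, mem_univ, true_and, heval]
  have hge : 1 - Real.exp (-((n : ℝ) ^ c')) ≤ bFn n (H n) := h1n.trans_eq hkey
  linarith [ha0 n (H n)]

/-- **Theorem 2 (strongest printed form) conditional on Theorem 1 alone**: Lemma 23 is proved
(`Rossman2010_plantedVsConditioned_holds`, `RossmanMonotoneCliqueLemma23Proofs.lean`), so
`Rossman2010_cliqueVsSubcritical → Rossman2010_twoThresholds`.
[cite: Rossman2010, Thm 2 (p. 4; proof §7 p. 10 and App. B pp. 13–14)] -/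
theorem Rossman2010_twoThresholds_of_cliqueVsSubcritical (h₁ : Rossman2010_cliqueVsSubcritical) :
    Rossman2010_twoThresholds :=
  Rossman2010_twoThresholds_of_thm1_lemma23 h₁ Rossman2010_plantedVsConditioned_holds

/-- The headline Theorem 2 ("monotone circuits solving `k`-clique on random graphs have size
`ω(n^{k/4})`", i.e. a.a.s. correct on `G(n,p)` for every `p : ℕ → [0,1]`) conditional on
Theorem 1 alone. [cite: Rossman2010, Thm 2 (p. 4)] -/
theorem Rossman2010_allDensities_of_cliqueVsSubcritical (h₁ : Rossman2010_cliqueVsSubcritical)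
    {k : ℕ} (hk : 5 ≤ k) (C : (n : ℕ) → Circuit ((⊤ : SimpleGraph (Fin n)).edgeSet))
    (hC : ∀ᶠ n : ℕ in atTop, (C n).IsOver monotoneBasis01)
    (hsolve : ∀ p : ℕ → ℝ, (∀ n, 0 ≤ p n ∧ p n ≤ 1) → SolvesCliqueAAS k p C) :
    Tendsto (fun n => ((C n).size : ℝ) / (n : ℝ) ^ ((k : ℝ) / 4)) atTop atTop :=
  (Rossman2010_twoThresholds_of_cliqueVsSubcritical h₁).allDensities hk C hC hsolve

/-! ### Theorem 2, unconditionally -/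

/-- **Rossman 2010, Theorem 2 (strongest printed form)** — discharge of the named fact
`Rossman2010_twoThresholds`: "monotone circuits which solve `k`-clique a.a.s. on `G(n,p)` and on
`G(n, p + p^{1+ε})`, `p ∈ Θ(n^{-2/(k-1)})`, have size `ω(n^{k/4})`" (`k ≥ 5`, fan-in-2 circuits
over `{∧₂, ∨₂, 0, 1}`, all `0 < ε ≤ ε₀ = k⁻³/2`). The §7 / Appendix B deduction
`Rossman2010_twoThresholds_of_cliqueVsSubcritical` (this file, with Lemma 23 =
`Rossman2010_plantedVsConditioned_holds`) applied to the proved Theorem 1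
(`Rossman2010_cliqueVsSubcritical_holds`, `RossmanMonotoneCliqueProofs.lean`).
[cite: Rossman2010, Thm 2 (p. 4; proof §7 p. 10 and App. B pp. 13–14)] -/
theorem Rossman2010_twoThresholds_holds : Rossman2010_twoThresholds :=
  Rossman2010_twoThresholds_of_cliqueVsSubcritical Rossman2010_cliqueVsSubcritical_holds

/-- **Theorem 2, headline form, unconditionally** ("Monotone circuits solving `k`-clique on random
graphs have size `ω(n^{k/4})`", p. 4): for `k ≥ 5`, a sequence of fan-in-2 monotone circuits
(over `{∧₂, ∨₂, 0, 1}`, eventually) that is a.a.s. correct for `k`-CLIQUE on `G(n,p)` for every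
`p : ℕ → [0,1]` has `|C n| / n^{k/4} → ∞`. [cite: Rossman2010, Thm 2 (p. 4)] -/
theorem Rossman2010_sizeOmega_of_solvesCliqueAAS {k : ℕ} (hk : 5 ≤ k)
    (C : (n : ℕ) → Circuit ((⊤ : SimpleGraph (Fin n)).edgeSet))
    (hC : ∀ᶠ n : ℕ in atTop, (C n).IsOver monotoneBasis01)
    (hsolve : ∀ p : ℕ → ℝ, (∀ n, 0 ≤ p n ∧ p n ≤ 1) → SolvesCliqueAAS k p C) :
    Tendsto (fun n => ((C n).size : ℝ) / (n : ℝ) ^ ((k : ℝ) / 4)) atTop atTop :=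
  Rossman2010_twoThresholds_holds.allDensities hk C hC hsolve

/-- Theorem 2, headline form, for circuits over the constant-free monotone basis `{∧₂, ∨₂}` (the
basis of route PneNP/OneSlice), unconditionally. [cite: Rossman2010, Thm 2 (p. 4)] -/
theorem Rossman2010_sizeOmega_of_solvesCliqueAAS_monotoneBasis {k : ℕ} (hk : 5 ≤ k)
    (C : (n : ℕ) → Circuit ((⊤ : SimpleGraph (Fin n)).edgeSet))
    (hC : ∀ᶠ n : ℕ in atTop, (C n).IsOver monotoneBasis)
    (hsolve : ∀ p : ℕ → ℝ, (∀ n, 0 ≤ p n ∧ p n ≤ 1) → SolvesCliqueAAS k p C) :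
    Tendsto (fun n => ((C n).size : ℝ) / (n : ℝ) ^ ((k : ℝ) / 4)) atTop atTop :=
  Rossman2010_sizeOmega_of_solvesCliqueAAS hk C
    (hC.mono fun _ hn => hn.mono monotoneBasis_subset_monotoneBasis01) hsolve

end Literature.Computability.Complexity

end
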